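import Literature.AnabelianGeometry.EtaleTheta.SettingModelTateSemidirect
import Literature.AnabelianGeometry.EtaleTheta.SettingModel2CoveringsSemidirectWeak
import Literature.AnabelianGeometry.EtaleTheta.SettingModelChiTheta
import Literature.AnabelianGeometry.EtaleTheta.SettingModelKummerCocyclePTate
import Literature.AnabelianGeometry.EtaleTheta.SettingModelKummerCocycleFixedField
import HarnessLib

/-!
# The STAGE-2 («Tate shear») model of the [EtTh] §1 root, file F5q: coverings `Π^tp_{Y_N}`, `Π^tp_{Z_N}` and
# the record `ThetaSetting.modelχq p i j`

Mochizuki, *The étale theta function …*, Publ. RIMS **45** (2009) [EtTh], §1, PRIMS PDF pp. 11–14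
[cite: MochizukiEtTh2009, §1 p.13]: "`K_N := K(ζ_N, q_X^{1/N})`", "`1 → (Δ^tp_Y)^ell ⊗ ℤ/Nℤ → Gal(Y_N/Y) →
Gal(K_N/K) → 1`", "`J_N := K_N(a^{1/N})_{a ∈ K_N}`", "`Π^tp_X/Π^tp_{Z_N} = Gal(Z_N/X)`" (Prop. 1.1 (ii), p. 15).
Layer L2 of the abc-iut cell, R78 cluster STAGE 2 (integrator abc-iut-L6-d6), hand **F5q** = seat abc-iut-L2-t5
(gen 6; L2-lead ruling R204): abc-iut-L2-t1's stage-1 files F5a/F5b (`SettingModelChiCoverings` /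
`SettingModelChiTheta`, `Π^tp_X = Γ ⋊_χ G_{ℚ_p}`) TRANSCRIBED to abc-iut-w5-d249's stage-2 carrier `curveχq p i j`
(F4q, `SettingModelTateSemidirect`: `Π^tp_X := Γ ⋊_{actχq} G_{ℚ_p}` for the AFFINE action
`a ↦ Inn(b^{κ_p(σ)^i})(a · b^{κ_p(σ)^j})`, `b ↦ b^{χ(σ)}`, `Γ = F̂₂ ×_Ẑ ℤ`), over abc-iut-L6-d6's weak twist data
`GfpTwistData₀` (`SettingModel2CoveringsSemidirectWeak`). Imports BY NAME; nothing of stage 1 is restated.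

What is NEW relative to stage 1 (and why the weak file's `YN_normal₀` is not used for `Y_N`):

* `hHat_shear_y` / `hHat_affTwist₃_y` / **`levelHom_actχq_y`** — the level law of the stage-2 action on ALL of
  `Γ` for the ABELIAN coordinates of `Heis(ℤ/N)`: `x` is fixed and
  `y(σ·γ) = χ_N(σ)·y(γ) + (κ_p(σ)^j mod N)·x(γ)` (the shear contributes `k·deg`, the inner `b`-power nothing, the
  twist `χ_N`); no formula for `z` is claimed (the shear does not descend to `Heis(ℤ/N)`, `N` even — R78-MAP #5).
* **`GfpTwistData₀.YN_normal_of_y`** — `Δ^tp_{Y_N} ⋊ B` is normal as soon as `B ⊴ G` preserves the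
  `y`-coordinate at level `N` on all of `Γ` (the cross term `γ·(b·γ)⁻¹` has degree `0`, so only `y` matters);
  the weak file's `YN_normal₀` asks for full level-`N` triviality, which FAILS at `B = G_{K_N}` here: at
  `q_X = p²`, `G_{K_N} = {χ_N = 1 ∧ κ_p² ≡ 0 (N)}` (`mem_GKNq_iff`), strictly larger than
  `{χ_N = 1 ∧ κ_p ≡ 0 (N)}` for even `N`.
* `tateTwistData₀ p i j`, `YNχq`, `ZNχq`; **`YNχq_normal`** for EVEN `j` (`jκ_p ≡ 0` on `G_{K_N}`; false for
  odd `j`, witness `N = 2`), **`ZNχq_normal`** for all `(i, j)` (`p^{1/N} ∈ J_N`, so `G_{J_N}` IS level-`N`-trivial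
  on all of `Γ` — the weak file's `ZN_normal₀`).
* **`ThetaSetting.modelχq p i j hj`** (`hj : Even j`) — fields verbatim as `modelχ`: `K := ℚ_p`, `q_X := p²`,
  `q̈ := p` (`κ(q̈) = κ_p`, `κ(q_X) = 2κ_p` = the shear at `j = 2`; the sign of `i` in the Tate instance is the
  integrator's ruling — abc-iut-w5-d249's deck-relation certificate `SettingModelTateDeckRelation` gives
  `(i, j) = (1, 2)` for abc-iut-L2-t12's class-two normal form); `modelχq_isEtThOrigin`, `hYcl_modelχq`,
  `isOpenMap_aug_modelχq`.

HONEST LABEL: a semi-synthetic model — consistency evidence for the typed interface, NOT the tempered `π₁` of a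
curve; nothing of [EtTh] is asserted; nothing here bears on [IUTchIII] Cor. 3.12. Class (b) MODEL/CONSTRUCTION
file (def-bearing; the only instances are the two `Normal` re-exports on the new quotient carriers).
-/

noncomputable section

open Topology Function

namespace Literature.AnabelianGeometry.EtaleTheta.SettingModel

open Literature.AnabelianGeometry.SemiGraphs

/-! ### The abelian coordinates of `Heis(ℤ/N)` under shear, inner `b`-powers and the three-parameter action -/

/-- The `x`-coordinate of `ĥ_N` is unchanged by a shear (`ê ∘ shear = ê`). [cite: MochizukiEtTh2009, §1 p.13] -/
theorem hHat_shear_x (N : ℕ+) (k : ZH) (x : F₂hatT) : (hHat N (shear k x)).x = (hHat N x).x := by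
  apply Multiplicative.ofAdd.injective
  rw [hHat_x_eq_modN_eHat, hHat_x_eq_modN_eHat, eHat_shear]

/-- **The `y`-coordinate under the shear `a ↦ a·b^k`, on ALL of `F̂₂`**: `y(ĥ_N(shear k x)) = y(ĥ_N x) +
(k mod N)·x(ĥ_N x)` (two continuous homomorphisms `F̂₂ → ℤ/N` agreeing on `η a`, `η b`).
[cite: MochizukiEtTh2009, §1 p.13] -/
theorem hHat_shear_y (N : ℕ+) (k : ZH) (x : F₂hatT) :
    (hHat N (shear k x)).y = (hHat N x).y + Multiplicative.toAdd (ZHatLevel.level N k) * (hHat N x).x := by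
  set K : ZMod N := Multiplicative.toAdd (ZHatLevel.level N k) with hK
  let D₁ : F₂hatT →ₜ* Multiplicative (ZMod N) :=
    { toMonoidHom := Heis.yHom.comp ((hHat N).toMonoidHom.comp (shearEnd k).toMonoidHom)
      continuous_toFun := (continuous_of_discreteTopology (f := fun h : Heis (ZMod N) => Heis.yHom h)).comp
        ((hHat N).continuous.comp (shearEnd k).continuous) }
  let D₂ : F₂hatT →ₜ* Multiplicative (ZMod N) :=
    { toFun := fun x => Multiplicative.ofAdd ((hHat N x).y + K * (hHat N x).x)
      map_one' := by rw [map_one, Heis.one_y, Heis.one_x, mul_zero, add_zero, ofAdd_zero]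
      map_mul' := fun a b => by
        rw [map_mul, Heis.mul_y, Heis.mul_x, ← ofAdd_add]
        congr 1
        ring
      continuous_toFun :=
        (continuous_of_discreteTopology
          (f := fun h : Heis (ZMod N) => Multiplicative.ofAdd (h.y + K * h.x))).comp (hHat N).continuous }
  have hD₁ : ∀ x, D₁ x = Multiplicative.ofAdd (hHat N (shear k x)).y := fun _ => rfl
  have hD₂ : ∀ x, D₂ x = Multiplicative.ofAdd ((hHat N x).y + K * (hHat N x).x) := fun _ => rfl
  have h : D₁ = D₂ := by
    refine ext_of_eta ?_ ?_
    · rw [hD₁, hD₂, shear_eta_of_zero, map_mul, hHat_bPow, hHat_eta, heisHom_of_zero, Heis.map_apply]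
      simp [hK]
    · rw [hD₁, hD₂, shear_apply, shearEnd_eta_of_one, hHat_eta, heisHom_of_one, Heis.map_apply]
      simp
  have hx := DFunLike.congr_fun h x
  rw [hD₁, hD₂] at hx
  exact Multiplicative.ofAdd.injective hx

/-- An inner `b`-power does not move the `x`-coordinate of `ĥ_N`. [cite: MochizukiEtTh2009, §1 p.13] -/
theorem hHat_innB_x (N : ℕ+) (t : ZH) (x : F₂hatT) : (hHat N (innB t x)).x = (hHat N x).x := by
  rw [hHat_innB, Heis.mul_x, Heis.mul_x, Heis.inv_x]
  ring

/-- An inner `b`-power does not move the `y`-coordinate of `ĥ_N`. [cite: MochizukiEtTh2009, §1 p.13] -/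
theorem hHat_innB_y (N : ℕ+) (t : ZH) (x : F₂hatT) : (hHat N (innB t x)).y = (hHat N x).y := by
  rw [hHat_innB, Heis.mul_y, Heis.mul_y, Heis.inv_y]
  ring

/-- The three-parameter action fixes the `x`-coordinate of `ĥ_N`. [cite: MochizukiEtTh2009, §1 p.13] -/
theorem hHat_affTwist₃_x (N : ℕ+) (m k : ZH) (α : MulAut ZH) (x : F₂hatT) :
    (hHat N (affTwist₃ ⟨(m, k), α⟩ x)).x = (hHat N x).x := by
  rw [affTwist₃_apply, hHat_innB_x, hHat_shear_x, hHat_twist, Heis.diagTwist_apply]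

/-- **The `y`-coordinate under the three-parameter action, on ALL of `F̂₂`**:
`y(ĥ_N(⟨(m,k),α⟩·x)) = χ_N(α)·y(ĥ_N x) + (k mod N)·x(ĥ_N x)`. [cite: MochizukiEtTh2009, §1 p.13] -/
theorem hHat_affTwist₃_y (N : ℕ+) (m k : ZH) (α : MulAut ZH) (x : F₂hatT) :
    (hHat N (affTwist₃ ⟨(m, k), α⟩ x)).y =
      ZHatLevel.levelChar N α * (hHat N x).y + Multiplicative.toAdd (ZHatLevel.level N k) * (hHat N x).x := by
  rw [affTwist₃_apply, hHat_innB_y, hHat_shear_y, hHat_twist, Heis.diagTwist_apply]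

variable (p : ℕ) [Fact p.Prime] (i j : ℤ)

/-- The stage-2 action fixes the `x`-coordinate (= degree mod `N`) of the level map on `Γ`.
[cite: MochizukiEtTh2009, §1 p.13] -/
theorem levelHom_actχq_x (N : ℕ+) (σ : GQp p) (γ : Gfp) :
    (levelHom N (actχq p i j σ γ)).x = (levelHom N γ).x := by
  show (hHat N (gfpFst (actχq p i j σ γ))).x = (hHat N (gfpFst γ)).x
  rw [gfpFst_actχq, actHatχq_apply, hHat_affTwist₃_x]

/-- **The stage-2 level law for the `y`-coordinate on ALL of `Γ`**: `y(σ·γ) = χ_N(σ)·y(γ) + (κ_p(σ)^j mod N)·x(γ)`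
("`G_{K_N}` acts trivially on `(Δ^tp_X)^ell/N·(Δ^tp_Y)^ell`" iff `χ_N = 1` and `jκ_p ≡ 0`). [cite: MochizukiEtTh2009, §1 p.13] -/
theorem levelHom_actχq_y (N : ℕ+) (σ : GQp p) (γ : Gfp) :
    (levelHom N (actχq p i j σ γ)).y = ZHatLevel.levelChar N (chi p σ) * (levelHom N γ).y +
      Multiplicative.toAdd (ZHatLevel.level N (kappaP p σ ^ j)) * (levelHom N γ).x := by
  show (hHat N (gfpFst (actχq p i j σ γ))).y = ZHatLevel.levelChar N (chi p σ) * (hHat N (gfpFst γ)).y +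
      Multiplicative.toAdd (ZHatLevel.level N (kappaP p σ ^ j)) * (hHat N (gfpFst γ)).x
  rw [gfpFst_actχq, actHatχq_apply, hHat_affTwist₃_y]

/-! ### Normality of `Δ^tp_{Y_N} ⋊ B` from the `y`-coordinate alone (any weak twist data) -/

variable {p i j}

/-- **`Π^tp_{Y_N} := Δ^tp_{Y_N} ⋊ B` is normal in `Γ ⋊_φ G`** when `B ⊴ G` preserves the `y`-coordinate of the level-`N`
map on all of `Γ` — the cross term `γ·(φ_b γ)⁻¹` has degree `0`, so membership in `Δ^tp_{Y_N} = {deg = 0, y ≡ 0}`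
only needs `y`; full level-`N` triviality (abc-iut-L6-d6's `YN_normal₀`) is not required. [cite: MochizukiEtTh2009, §1 p.14] -/
theorem GfpTwistData₀.YN_normal_of_y {G : Type*} [Group G] {φ : G →* MulAut Gfp} (T : GfpTwistData₀ φ) (N : ℕ+)
    (B : Subgroup G) [B.Normal] (hBy : ∀ ⦃b⦄, b ∈ B → ∀ γ : Gfp, (levelHom N (φ b γ)).y = (levelHom N γ).y) :
    (T.YN N B).Normal := by
  haveI := dY_normal N
  refine Semidirect.twistedProd_normal (T.act_mem_dY N) ?_
  intro b hb γ
  have hdeg : γ * (φ b γ)⁻¹ ∈ gfpSnd.ker := by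
    rw [MonoidHom.mem_ker, map_mul, map_inv, T.hdeg b γ, mul_inv_cancel]
  refine Subgroup.mem_inf.mpr ⟨hdeg, Subgroup.mem_comap.mpr ⟨levelHom_x_eq_zero hdeg, ?_⟩⟩
  show (levelHom N (γ * (φ b γ)⁻¹)).y = 0
  rw [map_mul, map_inv, Heis.mul_y, Heis.inv_y, hBy hb γ, add_neg_cancel]

variable (p i j)

/-! ### The twist data and the coverings of the stage-2 model (`K := ℚ_p`, `q_X := p²`) -/

/-- **The weak twist data of `actχq`**: degree preserved; on degree `0` the level shadow is `diagTwist (χ_N σ)`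
(F4q's `hHat_gfpFst_actχq_of_gfpSnd_eq_one`). [cite: MochizukiEtTh2009, §1 p.13] -/
def tateTwistData₀ : GfpTwistData₀ (actχq p i j) where
  hdeg σ γ := gfpSnd_actχq p i j σ γ
  δ N σ := Heis.diagTwist (ZHatLevel.levelChar N (chi p σ))
  δ_zAxis N σ h hh := by
    obtain ⟨hx, hy⟩ := hh
    refine ⟨?_, ?_⟩
    · show (Heis.diagTwist _ h).x = 0
      rw [Heis.diagTwist_apply]; exact hx
    · show (Heis.diagTwist _ h).y = 0
      rw [Heis.diagTwist_apply]
      show _ * h.y = 0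
      rw [hy, mul_zero]
  δ_one N σ := map_one _
  hlev₀ N σ γ hγ := hHat_gfpFst_actχq_of_gfpSnd_eq_one p i j N σ hγ

/-- **`G_{K_N}` at `q_X = p²` in the cocycle currency**: `σ ∈ G_{ℚ_p(μ_N, (p²)^{1/N})} ↔ χ_N(σ) = 1 ∧ κ_p(σ)² ≡ 0 (N)`
(abc-iut-L2-t5's `mem_fixingSubgroup_fieldKN_units_iff` at the root system `(p^{1/N})²` of `p²`).
[cite: MochizukiEtTh2009, §1 p.13] -/
theorem mem_GKNq_iff (σ : GQp p) (N : ℕ+) :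
    σ ∈ (fieldKN ⊥ (qModel p) N).fixingSubgroup ↔
      ZHatLevel.levelChar N (chi p σ) = 1 ∧ ZHatLevel.level N (kappaP p σ ^ 2) = 1 := by
  rw [← kummerZH_qRootsOfP p σ, ← coe_qUnit]
  exact mem_fixingSubgroup_fieldKN_units_iff (qRootsOfP p) (mem_fixedPoints_top_of_forall (smul_qUnit p)) σ N

/-- For EVEN `j`, `κ_p(σ)^j ≡ 0 (N)` on `G_{K_N}` (`κ_p^j = (κ_p²)^{j/2}`). [cite: MochizukiEtTh2009, §1 p.13] -/
theorem level_kappaP_zpow_eq_one_of_mem_GKNq (hj : Even j) {σ : GQp p} {N : ℕ+}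
    (hσ : σ ∈ (fieldKN ⊥ (qModel p) N).fixingSubgroup) : ZHatLevel.level N (kappaP p σ ^ j) = 1 := by
  obtain ⟨j', rfl⟩ := hj
  rw [← two_mul, zpow_mul, zpow_ofNat, map_zpow, ((mem_GKNq_iff p σ N).mp hσ).2, one_zpow]

/-- `p^{1/N} ∈ J_N` (`p ∈ ℚ_p ⊆ K_N` and `J_N := K_N(a^{1/N})_{a ∈ K_N}`), so `σ ∈ G_{J_N}` fixes `p^{1/N}`.
[cite: MochizukiEtTh2009, §1 p.14] -/
theorem apply_pRoot_of_mem_GJNq {σ : GQp p} {N : ℕ+} (hσ : σ ∈ (fieldJN ⊥ (qModel p) N).fixingSubgroup) :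
    σ (pRoot p N) = pRoot p N := by
  refine (IntermediateField.mem_fixingSubgroup_iff _ _).mp hσ _ (IntermediateField.subset_adjoin _ _ (Or.inr ?_))
  show pRoot p N ^ (N : ℕ) ∈ fieldKN ⊥ (qModel p) N
  rw [pRoot_pow]
  exact IntermediateField.subset_adjoin _ _ (Or.inl (natCast_mem _ p))

/-- **`Π^tp_{Y_N} := Δ^tp_{Y_N} ⋊ G_{K_N} ≤ Γ ⋊_{actχq} G_{ℚ_p}`**. [cite: MochizukiEtTh2009, §1 p.13] -/
def YNχq (N : ℕ+) : Subgroup (PiTpχq p i j) := (tateTwistData₀ p i j).YN N (fieldKN ⊥ (qModel p) N).fixingSubgroup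

/-- **`Π^tp_{Z_N} := Δ^tp_{Z_N} ⋊ G_{J_N}`**. [cite: MochizukiEtTh2009, §1 p.14] -/
def ZNχq (N : ℕ+) : Subgroup (PiTpχq p i j) := (tateTwistData₀ p i j).ZN N (fieldJN ⊥ (qModel p) N).fixingSubgroup

/-- **`Π^tp_{Y_N}` is normal in `Π^tp_X`** for even `j`: on `G_{K_N}`, `χ_N = 1` and `jκ_p ≡ 0 (N)`, so the
`y`-coordinate is preserved on all of `Γ` (`levelHom_actχq_y`). [cite: MochizukiEtTh2009, §1 p.14] -/
theorem YNχq_normal (hj : Even j) (N : ℕ+) : (YNχq p i j N).Normal := by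
  haveI := fixingSubgroup_fieldKN_bot_normal _ (qModel_mem_botχ p) N
  refine (tateTwistData₀ p i j).YN_normal_of_y N _ fun σ hσ γ => ?_
  rw [levelHom_actχq_y, levelChar_chi_eq_one_of_mem_fixingSubgroup_fieldKN p ⊥ (qModel p) N hσ,
    level_kappaP_zpow_eq_one_of_mem_GKNq p j hj hσ, toAdd_one, one_mul, zero_mul, add_zero]

/-- **`Π^tp_{Z_N}` is normal in `Π^tp_X`** (all `i, j`): `G_{J_N}` fixes `μ_N` and `p^{1/N}`, hence acts
level-`N`-trivially on all of `Γ` (F4q's `hHat_gfpFst_actχq_of_level`). [cite: MochizukiEtTh2009, §1 p.15] -/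
theorem ZNχq_normal (N : ℕ+) : (ZNχq p i j N).Normal := by
  haveI := fixingSubgroup_fieldJN_bot_normal _ (qModel_mem_botχ p) N
  refine (tateTwistData₀ p i j).ZN_normal₀ N _ fun σ hσ γ => ?_
  exact hHat_gfpFst_actχq_of_level p i j N (levelChar_chi_eq_one_of_mem_fixingSubgroup_fieldJN p ⊥ (qModel p) N hσ)
    ((level_kappaP_eq_one_iff p σ N).mpr (apply_pRoot_of_mem_GJNq p hσ)) γ

/-- `Π^tp_{Y_1} = Π^tp_Y = Ker(Π^tp_X ↠ Z)`. [cite: MochizukiEtTh2009, §1 p.14] -/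
theorem YNχq_one : YNχq p i j 1 = (tateTwistData₀ p i j).toZ.ker := by
  rw [← GfpTwistData₀.YN_one_top]
  unfold YNχq GfpTwistData₀.YN
  exact Semidirect.twistedProd_eq_of_eq rfl
    (by rw [fieldKN_bot_one _ (qModel_mem_botχ p), IntermediateField.fixingSubgroup_bot])

/-- `Π^tp_{Y_N} ↠ G_{K_N}`. [cite: MochizukiEtTh2009, §1 p.13] -/
theorem map_rightHom_YNχq (N : ℕ+) :
    (YNχq p i j N).map SemidirectProduct.rightHom = (fieldKN ⊥ (qModel p) N).fixingSubgroup :=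
  (tateTwistData₀ p i j).map_rightHom_YN N _

/-- `Π^tp_{Z_N} ↠ G_{J_N}`. [cite: MochizukiEtTh2009, §1 p.14] -/
theorem map_rightHom_ZNχq (N : ℕ+) :
    (ZNχq p i j N).map SemidirectProduct.rightHom = (fieldJN ⊥ (qModel p) N).fixingSubgroup :=
  (tateTwistData₀ p i j).map_rightHom_ZN N _

/-! ### The theta quotients at `curveχq` and the clause `Ker(Π^tp_X ↠ (Π^tp_X)^Θ) ∩ Π^tp_{Y_N} ≤ Π^tp_{Z_N}` -/

/-- `Ker(Π^tp_X ↠ (Π^tp_X)^Θ)` is normal — abc-iut-L2-d1's generic instance RE-EXPORTED at the concrete carrier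
`Γ ⋊_{actχq} G_{ℚ_p}` (instance search keys the carrier). [cite: MochizukiEtTh2009, §1 p.12] -/
instance thetaKer_curveχq_normal : (CurveTheta.thetaKer (curveχq p i j)).Normal := CurveTheta.thetaKer_normal _

/-- `Ker(Π^tp_X ↠ (Π^tp_X)^ell)` is normal (re-export at the concrete carrier). [cite: MochizukiEtTh2009, §1 p.12] -/
instance ellKer_curveχq_normal : (CurveTheta.ellKer (curveχq p i j)).Normal := CurveTheta.ellKer_normal _

/-- `Δ_X ≤ inl(F̂₂)` in `Π_X = F̂₂ ⋊ G_{ℚ_p}`. [cite: MochizukiEtTh2009, §1 p.12] -/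
theorem deltaHatχq_le_range_inl :
    (curveχq p i j).DeltaHat ≤ (SemidirectProduct.inl : F₂hatT →* PiHtχq p i j).range := by
  rw [deltaHatχq_eq, ← SemidirectProduct.range_inl_eq_ker_rightHom]

/-- **The level maps kill `Ker(Π^tp_X ↠ (Π^tp_X)^Θ)`** at the stage-2 model. [cite: MochizukiEtTh2009, §1 p.14] -/
theorem levelHom_eq_one_of_mem_thetaKerχq {g : PiTpχq p i j} (hg : g ∈ CurveTheta.thetaKer (curveχq p i j))
    (N : ℕ+) : levelHom N g.left = 1 := by
  have hmem : toHatχq p i j g ∈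
      (⁅⁅(curveχq p i j).DeltaHat, (curveχq p i j).DeltaHat⁆, (curveχq p i j).DeltaHat⁆).topologicalClosure := hg
  have h := hHat_left_eq_one_of_mem_closure_commutator₃_of_le (isInducing_leftRightHatχq p i j)
    (deltaHatχq_le_range_inl p i j) hmem N
  show hHat N (gfpFst g.left) = 1
  rw [← toHatχq_left p i j g]
  exact h.1

/-- **`Ker(Π^tp_X ↠ (Π^tp_X)^Θ) ∩ Π^tp_{Y_N} ≤ Π^tp_{Z_N}`** at the stage-2 model. [cite: MochizukiEtTh2009, §1 p.14] -/
theorem thetaKer_inf_YNχq_le_ZNχq (N : ℕ+) : CurveTheta.thetaKer (curveχq p i j) ⊓ YNχq p i j N ≤ ZNχq p i j N := by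
  intro g hg
  obtain ⟨hT, hY⟩ := Subgroup.mem_inf.mp hg
  have hright : g.right = 1 :=
    (mem_deltaTempχq_iff p i j g).mp (CurveTheta.thetaKer_le_deltaTemp (curveχq p i j) hT)
  exact (tateTwistData₀ p i j).mem_ZN_of_levelHom_eq_one hY (levelHom_eq_one_of_mem_thetaKerχq p i j hT N)
    (by rw [hright]; exact Subgroup.one_mem _)

/-! ### The record -/

/-- **The stage-2 («Tate shear») model of the [EtTh] §1 root** (`Π^tp_X := (F̂₂ ×_Ẑ ℤ) ⋊_{(κ_p^i, κ_p^j, χ)} G_{ℚ_p}`,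
`K := ℚ_p`, `q_X := p²`, `q̈ := p`, `Y_N`/`Z_N` from the profinite level maps twisted by `G_{K_N}`/`G_{J_N}`), for
even `j`; the Tate instance has `j = 2` (`κ(q_X) = 2κ_p` is the shear), the sign of `i` being the integrator's
ruling (abc-iut-w5-d249's deck-relation certificate: `(i, j) = (1, 2)`). SEMI-SYNTHETIC (not the tempered `π₁`
of a curve). [cite: MochizukiEtTh2009, §1 p.11] -/
abbrev _root_.Literature.AnabelianGeometry.EtaleTheta.ThetaSetting.modelχq (hj : Even j) : ThetaSetting p where
  toTemperedCurve := curveχq p i j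
  qX := qModel p
  qX_mem := qModel_mem_botχ p
  norm_qX_lt_one := (ThetaSetting.model p).norm_qX_lt_one
  qX_ne_zero := qModel_ne_zeroχ p
  sqrtqX := ((p : ℕ) : PadicAlgCl p)
  sqrtqX_sq := rfl
  toZ := (tateTwistData₀ p i j).toZ
  toZ_surjective := (tateTwistData₀ p i j).toZ_surjective
  isOpen_ker_toZ := (tateTwistData₀ p i j).isOpen_ker_toZ (continuous_leftRightχq p i j)
  toZ_delta_surjective := (tateTwistData₀ p i j).toZ_restrict_surjective
  GtpTheta := CurveTheta.GTheta (curveχq p i j)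
  toTheta := CurveTheta.toTheta (curveχq p i j)
  continuous_toTheta := CurveTheta.continuous_toTheta (curveχq p i j)
  toTheta_surjective := CurveTheta.toTheta_surjective (curveχq p i j)
  ker_toTheta := CurveTheta.ker_toTheta (curveχq p i j)
  GtpEll := CurveTheta.GEll (curveχq p i j)
  thetaToEll := CurveTheta.thetaToEll (curveχq p i j)
  continuous_thetaToEll := CurveTheta.continuous_thetaToEll (curveχq p i j)
  thetaToEll_surjective := CurveTheta.thetaToEll_surjective (curveχq p i j)
  ker_toEll := CurveTheta.ker_toEll (curveχq p i j)
  ker_thetaToEll_comm := CurveTheta.ker_thetaToEll_comm (curveχq p i j)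
  ker_thetaToEll_central := CurveTheta.ker_thetaToEll_central (curveχq p i j)
  GtpYN := YNχq p i j
  GtpYN_one := YNχq_one p i j
  GtpYN_le N := (tateTwistData₀ p i j).YN_le N _
  map_aug_GtpYN N := map_rightHom_YNχq p i j N
  GtpYN_normal := YNχq_normal p i j hj
  isOpen_GtpYN N := (tateTwistData₀ p i j).isOpen_YN (continuous_leftRightχq p i j) N
    (isOpen_fixingSubgroup_fieldKN ⊥ (qModel p) N)
  GtpYN_anti M N h := (tateTwistData₀ p i j).YN_anti h
    (IntermediateField.fixingSubgroup_antitone (fieldKN_bot_mono _ (qModel_ne_zeroχ p) h))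
  relIndex_deltaYN N := (tateTwistData₀ p i j).relIndex_YN N _
  GtpZN := ZNχq p i j
  GtpZN_le N := (tateTwistData₀ p i j).ZN_le_YN N
    (IntermediateField.fixingSubgroup_antitone (fieldKN_le_fieldJN _ ⊥ N))
  map_aug_GtpZN N := map_rightHom_ZNχq p i j N
  GtpZN_normal := ZNχq_normal p i j
  isOpen_GtpZN N := (tateTwistData₀ p i j).isOpen_ZN (continuous_leftRightχq p i j) N
    (isOpen_fixingSubgroup_fieldJN ⊥ (qModel p) N)
  GtpZN_anti M N h := (tateTwistData₀ p i j).ZN_anti h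
    (IntermediateField.fixingSubgroup_antitone (fieldJN_bot_mono _ (qModel_ne_zeroχ p) h))
  relIndex_deltaZN N := (tateTwistData₀ p i j).relIndex_ZN N _ _
  ker_toTheta_le_GtpZN N := by
    rw [CurveTheta.ker_toTheta]
    exact thetaKer_inf_YNχq_le_ZNχq p i j N

variable (hj : Even j)

/-- **The stage-2 model satisfies the guard `IsEtThOrigin`** (`Δ_X = inl(F̂₂)` is profinite free on two
generators; the shear changes the Galois action, not `Δ_X`). [cite: MochizukiEtTh2009, §1 p.12] -/
theorem _root_.Literature.AnabelianGeometry.EtaleTheta.ThetaSetting.modelχq_isEtThOrigin :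
    (ThetaSetting.modelχq p i j hj).IsEtThOrigin :=
  ThetaSetting.IsEtThOrigin.of_free (isFreeProfiniteOnTwo_deltaHatχq p i j)

/-- **The image of `Δ^tp_Y` in `Π_X` is `inl(Ker ê)`** (stage-2 model). [cite: MochizukiEtTh2009, §1 p.12] -/
theorem coe_map_dtpY_modelχq : ((ThetaSetting.modelχq p i j hj).DtpY.map (ThetaSetting.modelχq p i j hj).toHat.toMonoidHom :
    Set (PiHtχq p i j)) = (SemidirectProduct.inl : F₂hatT → PiHtχq p i j) '' (eHat ⁻¹' {1}) := by
  ext y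
  constructor
  · rintro ⟨g, hg, rfl⟩
    obtain ⟨hg1, hg2⟩ := Subgroup.mem_inf.mp hg
    have hsnd : gfpSnd g.left = 1 := hg1
    have hright : g.right = 1 := (mem_deltaTempχq_iff p i j g).mp hg2
    refine ⟨gfpFst g.left, ?_, ?_⟩
    · show eHat (gfpFst g.left) = 1
      rw [gfpFst_apply, (mem_Gfp _).mp g.left.2, ← gfpSnd_apply, hsnd, map_one]
    · apply SemidirectProduct.ext
      · rw [SemidirectProduct.left_inl]
        exact (toHatχq_left p i j g).symm
      · rw [SemidirectProduct.right_inl]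
        exact ((toHatχq_right p i j g).trans hright).symm
  · rintro ⟨x, hx, rfl⟩
    have hx' : eHat x = 1 := hx
    let γ : Gfp := ⟨(x, 1), by rw [mem_Gfp, hx', map_one]⟩
    refine ⟨SemidirectProduct.inl γ, Subgroup.mem_inf.mpr ⟨?_, ?_⟩, ?_⟩
    · show gfpSnd (SemidirectProduct.inl γ : PiTpχq p i j).left = 1
      rw [SemidirectProduct.left_inl, gfpSnd_apply]
    · exact (mem_deltaTempχq_iff p i j _).mpr (SemidirectProduct.right_inl γ)
    · apply SemidirectProduct.ext
      · show (toHatχq p i j (SemidirectProduct.inl γ)).left = x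
        rw [toHatχq_left, SemidirectProduct.left_inl, gfpFst_apply]
      · show (toHatχq p i j (SemidirectProduct.inl γ)).right = 1
        rw [toHatχq_right, SemidirectProduct.right_inl]

/-- **`hYcl` HOLDS at the stage-2 model**: the image of `Δ^tp_Y` in `Π_X` is closed.
[cite: MochizukiEtTh2009, §1 p.12] -/
theorem hYcl_modelχq :
    ((ThetaSetting.modelχq p i j hj).DtpY.map (ThetaSetting.modelχq p i j hj).toHat.toMonoidHom).topologicalClosure ≤
      (ThetaSetting.modelχq p i j hj).DtpY.map (ThetaSetting.modelχq p i j hj).toHat.toMonoidHom ⊔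
        (⁅⁅(ThetaSetting.modelχq p i j hj).DeltaHat, (ThetaSetting.modelχq p i j hj).DeltaHat⁆,
          (ThetaSetting.modelχq p i j hj).DeltaHat⁆).topologicalClosure := by
  refine (Subgroup.topologicalClosure_minimal _ le_rfl ?_).trans le_sup_left
  show IsClosed (((ThetaSetting.modelχq p i j hj).DtpY.map (ThetaSetting.modelχq p i j hj).toHat.toMonoidHom :
      Subgroup (PiHtχq p i j)) : Set (PiHtχq p i j))
  rw [coe_map_dtpY_modelχq]
  haveI : T2Space (GQp p) := krullTopology_t2
  exact isClosed_image_inl (isInducing_leftRightHatχq p i j) (isClosed_singleton.preimage eHat.continuous)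

/-- **Root + guard + `hYcl` hold together at the stage-2 model.** [cite: MochizukiEtTh2009, §1 p.12] -/
theorem _root_.Literature.AnabelianGeometry.EtaleTheta.ThetaSetting.modelχq_isEtThOrigin_and_hYcl :
    (ThetaSetting.modelχq p i j hj).IsEtThOrigin ∧
      ((ThetaSetting.modelχq p i j hj).DtpY.map (ThetaSetting.modelχq p i j hj).toHat.toMonoidHom).topologicalClosure ≤
        (ThetaSetting.modelχq p i j hj).DtpY.map (ThetaSetting.modelχq p i j hj).toHat.toMonoidHom ⊔
          (⁅⁅(ThetaSetting.modelχq p i j hj).DeltaHat, (ThetaSetting.modelχq p i j hj).DeltaHat⁆,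
            (ThetaSetting.modelχq p i j hj).DeltaHat⁆).topologicalClosure :=
  ⟨ThetaSetting.modelχq_isEtThOrigin p i j hj, hYcl_modelχq p i j hj⟩

/-- **`aug` is an OPEN map at the stage-2 model** (F4q's `isOpenMap_augχq`). [cite: MochizukiEtTh2009, §1 p.12] -/
theorem isOpenMap_aug_modelχq : IsOpenMap (ThetaSetting.modelχq p i j hj).aug := isOpenMap_augχq p i j

end Literature.AnabelianGeometry.EtaleTheta.SettingModel

end
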